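import Summits.ResolutionOfSingularities.ResolutionOfSingularities.Theorems.FrobeniusClosingPatchingRelPerfectDepthParamLiftFlat
import Summits.ResolutionOfSingularities.ResolutionOfSingularities.Theorems.FrobeniusClosingPatchingRelPerfectDepthTaylorInitialCharts
import Literature.AlgebraicGeometry.Resolution.ProjectiveSpaceExcellent
import HarnessLib

/-!
# `PatchingRelPerfect` (stmt-ResolutionOfSingularities-16161), chain W5.2 — F7(β) (β-AX) T0: PARAM-LIFT of the line-bundle retraction
# `R₀ : X₁ = Bl_𝔪 Spec S ⟶ ℙᵐ_{κ₀}` — at the points of `E`, and the assembly on `V = ⊤`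

[OURS · L1 W5.2 · res-D-pv-055 (hand for T0; plan-1 RULINGS G11-18/27/31, spec v4.2 §7 A3)] The input `hparam` of the T0 packaging
`initialMultiHost₂_of_param` (p552524) asks for pv-034's parameter-lift property `IsParamLiftAt (⊤.ι ≫ R₀) y` at every point of
`X₁`. This file proves:

* §1 `isParamLiftAt_retraction₀_of_mem_support` — AT THE POINTS OF `E`: `IsParamLiftAt R₀ y₀` for `y₀ ∈ Supp 𝓘_E = i(ℙᵐ)`,
  `i = (ι_E ≫ R₀)⁻¹ ≫ ι_E`,
  by pv-034's `IsParamLiftAt.of_retract` (p551652): `i ≫ R₀ = 𝟙`, `ker i = 𝓘_E` is an effective Cartier divisor (local equation `t ≠ 0`),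
  the stalks of the regular `X₁` and `ℙᵐ` are regular;
* §2 `isParamLiftAt_top_of_forall` — transport to `V = ⊤` (`IsParamLiftAt.of_stalkIso` along the open immersion `⊤.ι`);
* §3 `isParamLiftAt_top_retraction₀_of_offE` — the assembly: PARAM on `⊤` from PARAM at the points OFF `E` (the remaining input,
  «`DirectionMapRegular`»: res-D-pv-046's regular-homomorphism theorem + the chart plumbing + pv-034's kernel
  `isParamLiftAt_of_flat_of_isRegularLocalRing_fiber`).

Honest framing: OURS (AI-written, weaker than expert review); packaging of tree theorems; nothing here is a statement of the
manuscript under review.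

## Sources
* H. Matsumura, *Commutative Ring Theory* (1987), Thm. 23.7. [Matsumura1987]
* J. Kollár, *Lectures on Resolution of Singularities* (2007), (3.111) Step 1. [Kollar2007]
-/

set_option linter.dupNamespace false -- mandated namespace of this single-conjunct summit

noncomputable section

open CategoryTheory CategoryTheory.Limits AlgebraicGeometry Literature.AlgebraicGeometry.Resolution
open IsLocalRing TopologicalSpace HomogeneousLocalization Scheme.IdealSheafData
open Literature.AlgebraicGeometry.Motives Literature.AlgebraicGeometry.Motives.ProjBaseChangeRing

namespace Summit.ResolutionOfSingularities.ResolutionOfSingularities.Theorems.DepthMultiHost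

universe u

section Setup

variable {S : Type u} [CommRing S] [IsRegularLocalRing S] {m : ℕ} (y : Fin (m + 1) → S)
  (κ₀ : Type u) [Field κ₀] [Algebra κ₀ S]

local notation3 "X₁" => affineBlowup (Ideal.span (Set.range y))
/-- `r₀` written out (as in `…DepthGradedRetraction`). -/
local notation3 "R₀" => (Proj.map (reesPresentation y) (irrelevant_le_map_reesPresentation y) ≫
  Proj.map (mapGraded κ₀ S (Fin (m + 1))) (irrelevant_le_map κ₀ S (Fin (m + 1))) :
    affineBlowup (Ideal.span (Set.range y)) ⟶ ProjSpace.P m κ₀)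
/-- the exceptional ideal `𝓔 = 𝔪𝒪_{X₁}` -/
local notation3 "𝓔" => (affineBlowup.idealSheaf (Ideal.span (Set.range y))).comap
  (affineBlowup.π (Ideal.span (Set.range y)))
/-- the embedding `i = (ι_E ≫ r₀)⁻¹ ≫ ι_E : ℙᵐ_{κ₀} ⟶ X₁` -/
local notation3 "i₀" => inv ((𝓔).subschemeι ≫ R₀) ≫ (𝓔).subschemeι

/-! ## §1 PARAM at the points of `E` -/

/-- **PARAM-LIFT of `R₀` at the points of `E`.** At a point `y₀ ∈ Supp 𝓘_E = i(ℙᵐ)`, the retraction `R₀` has the parameter-lift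
property: `i ≫ R₀ = 𝟙`, `ker i = 𝓘_E` has a non-zero local equation `t`, and `𝒪_{X₁, y₀}`, `𝒪_{ℙᵐ, z}` are regular
(pv-034's `IsParamLiftAt.of_retract`; `i = (ι_E ≫ R₀)⁻¹ ≫ ι_E`, an isomorphism onto `E` for a quasi-regular `y` and a coefficient field).
[cite: Matsumura1987, Thm. 23.7] [cite: Kollar2007, (3.111) Step 1] -/
theorem isParamLiftAt_retraction₀_of_mem_support (hqr : IsQuasiRegular y)
    (hκ : Function.Bijective (algebraMap κ₀ (S ⧸ Ideal.span (Set.range y))))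
    (hy : Ideal.span (Set.range y) = IsLocalRing.maximalIdeal S) (y₀ : X₁) (hy₀ : y₀ ∈ ((𝓔).support : Set X₁)) :
    letI : GradedRing (MvPolynomial.homogeneousSubmodule (Fin (m + 1)) S) := MvPolynomial.gradedAlgebra
    letI : GradedRing (MvPolynomial.homogeneousSubmodule (Fin (m + 1)) κ₀) := MvPolynomial.gradedAlgebra
    IsParamLiftAt R₀ y₀ := by
  letI : GradedRing (MvPolynomial.homogeneousSubmodule (Fin (m + 1)) S) := MvPolynomial.gradedAlgebra
  letI : GradedRing (MvPolynomial.homogeneousSubmodule (Fin (m + 1)) κ₀) := MvPolynomial.gradedAlgebra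
  haveI := DepthOne.isIso_subschemeι_comp_retraction₀ y κ₀ hqr hκ
  -- `y₀ = i z` with `z = (ι_E ≫ R₀) e`
  rw [← Scheme.IdealSheafData.range_subschemeι] at hy₀
  obtain ⟨e, rfl⟩ := hy₀
  set z : ProjSpace.P m κ₀ := ((𝓔).subschemeι ≫ R₀).base e with hz
  have he : (i₀).base z = (𝓔).subschemeι.base e := by
    show (((𝓔).subschemeι ≫ R₀) ≫ i₀).base e = _
    rw [IsIso.hom_inv_id_assoc]
  rw [← he]
  haveI : IsRegularLocalRing ((X₁).presheaf.stalk ((i₀).base z)) := DepthOne.isRegular_blowup y hy _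
  haveI : IsRegularLocalRing ((ProjSpace.P m κ₀).presheaf.stalk z) :=
    (ProjectiveSpace.projSpace_standing m κ₀).2.2.1 z
  obtain ⟨t, ht0, ht⟩ :=
    (affineBlowup.isBlowup (Ideal.span (Set.range y))).isEffectiveCartier.exists_stalkIdeal_eq_span ((i₀).base z)
  refine IsParamLiftAt.of_retract R₀ (k := i₀) (DepthOne.emb_comp_retraction₀ y κ₀) z (t := t) ?_
    (nonZeroDivisors.ne_zero ht0)
  rw [DepthOne.ker_emb y κ₀]
  exact ht

/-! ## §2 Transport to `V = ⊤` -/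

omit [IsRegularLocalRing S] in
/-- PARAM for `⊤.ι ≫ R₀` at every point of `⊤` from PARAM for `R₀` at every point of `X₁` (`IsParamLiftAt.of_stalkIso` along the open
immersion `⊤.ι`). [folklore] -/
theorem isParamLiftAt_top_of_forall
    (h : letI : GradedRing (MvPolynomial.homogeneousSubmodule (Fin (m + 1)) S) := MvPolynomial.gradedAlgebra
      letI : GradedRing (MvPolynomial.homogeneousSubmodule (Fin (m + 1)) κ₀) := MvPolynomial.gradedAlgebra
      ∀ y₀ : X₁, IsParamLiftAt R₀ y₀) (w : ↥((⊤ : (X₁).Opens) : Scheme.{u})) :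
    letI : GradedRing (MvPolynomial.homogeneousSubmodule (Fin (m + 1)) S) := MvPolynomial.gradedAlgebra
    letI : GradedRing (MvPolynomial.homogeneousSubmodule (Fin (m + 1)) κ₀) := MvPolynomial.gradedAlgebra
    IsParamLiftAt ((⊤ : (X₁).Opens).ι ≫ R₀) w := by
  letI : GradedRing (MvPolynomial.homogeneousSubmodule (Fin (m + 1)) S) := MvPolynomial.gradedAlgebra
  letI : GradedRing (MvPolynomial.homogeneousSubmodule (Fin (m + 1)) κ₀) := MvPolynomial.gradedAlgebra
  haveI : IsIso (Scheme.Hom.stalkMap (𝟙 (ProjSpace.P m κ₀)) (((⊤ : (X₁).Opens).ι ≫ R₀) w)) := by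
    rw [Scheme.Hom.stalkMap_id]; exact IsIso.id _
  exact IsParamLiftAt.of_stalkIso R₀ ((⊤ : (X₁).Opens).ι ≫ R₀) (⊤ : (X₁).Opens).ι (𝟙 _)
    (by rw [Category.comp_id]) w (h _)

/-! ## §3 Assembly: PARAM on `⊤` from PARAM off `E` -/

/-- **PARAM on `V = ⊤` from PARAM at the points off `E`**: the points of `E` are `isParamLiftAt_retraction₀_emb`.
[cite: Matsumura1987, Thm. 23.7] -/
theorem isParamLiftAt_top_retraction₀_of_offE (hqr : IsQuasiRegular y)
    (hκ : Function.Bijective (algebraMap κ₀ (S ⧸ Ideal.span (Set.range y))))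
    (hy : Ideal.span (Set.range y) = IsLocalRing.maximalIdeal S)
    (hoff : letI : GradedRing (MvPolynomial.homogeneousSubmodule (Fin (m + 1)) S) := MvPolynomial.gradedAlgebra
      letI : GradedRing (MvPolynomial.homogeneousSubmodule (Fin (m + 1)) κ₀) := MvPolynomial.gradedAlgebra
      ∀ y₀ : X₁, y₀ ∉ ((𝓔).support : Set X₁) → IsParamLiftAt R₀ y₀)
    (w : ↥((⊤ : (X₁).Opens) : Scheme.{u})) :
    letI : GradedRing (MvPolynomial.homogeneousSubmodule (Fin (m + 1)) S) := MvPolynomial.gradedAlgebra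
    letI : GradedRing (MvPolynomial.homogeneousSubmodule (Fin (m + 1)) κ₀) := MvPolynomial.gradedAlgebra
    IsParamLiftAt ((⊤ : (X₁).Opens).ι ≫ R₀) w := by
  refine isParamLiftAt_top_of_forall y κ₀ (fun y₀ => ?_) w
  by_cases hy₀ : y₀ ∈ ((𝓔).support : Set X₁)
  · exact isParamLiftAt_retraction₀_of_mem_support y κ₀ hqr hκ hy y₀ hy₀
  · exact hoff y₀ hy₀

end Setup

end Summit.ResolutionOfSingularities.ResolutionOfSingularities.Theorems.DepthMultiHost

end
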